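import Summits.AtomisticToContinuum.BoseEinsteinCondensation.Theorems.BECHusimiAmplitudeGasPeriodicBECNonneg
import Summits.AtomisticToContinuum.BoseEinsteinCondensation.Theorems.BECHusimiAmplitudeGasLaplaceCapUnion

/-!
# `PeriodicBECNonneg` from the three ranked cruxes of route `BECHusimiAmplitudeGas`

The node `PeriodicBECNonneg` (item stmt-AtomisticToContinuum-11996: constant-mode BEC with
fraction `c > 0` for nonnegative periodic `δ`-near-minimisers at small density, uniformly in `N`)
is thermodynamic-limit Bose–Einstein condensation for the positive periodic ground sector — an
open problem as a free-standing statement. Inside the route every piece of glue is now a theorem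
of the tree:

* `laplaceCapUnion_proof : PhaseCapDecay → AmplitudeLDP → HusimiConcentration`
  (item stmt-AtomisticToContinuum-11995),
* `fastFractionBound_proof : FastFractionBound` (item stmt-AtomisticToContinuum-11993),
* `periodicBECNonneg_of_husimi : HusimiConcentration → TiltStability → FastFractionBound →
  PeriodicBECNonneg` (item stmt-AtomisticToContinuum-11997, `ratioToCondensate_holds`),

so the node depends on EXACTLY the three ranked cruxes `PhaseCapDecay`
(stmt-AtomisticToContinuum-11990), `AmplitudeLDP` (stmt-AtomisticToContinuum-11991) and
`TiltStability` (stmt-AtomisticToContinuum-11992), with condensate fraction `c = 1/4`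
(`periodicBECNonneg_of_cruxes`). This file records that composition; it is conditional on the
three cruxes and closes nothing by itself.
-/

namespace Summit.AtomisticToContinuum.BoseEinsteinCondensation.Theorems

open Summit.AtomisticToContinuum.BoseEinsteinCondensation.Theses.BECHusimiAmplitudeGas

/-- **The node modulo the three cruxes.** `PeriodicBECNonneg` (constant-mode BEC with fraction
`1/4` for nonnegative periodic near-minimisers at small density) follows from the route's three
ranked cruxes `PhaseCapDecay`, `AmplitudeLDP` and `TiltStability`; the Laplace bookkeeping
(`laplaceCapUnion_proof`), the fast-fraction bound (`fastFractionBound_proof`) and the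
ratio-to-condensate arithmetic (`periodicBECNonneg_of_husimi`) are theorems of the tree. [folklore] -/
theorem periodicBECNonneg_of_cruxes (h₁ : PhaseCapDecay) (h₂ : AmplitudeLDP) (h₃ : TiltStability) :
    PeriodicBECNonneg :=
  periodicBECNonneg_of_husimi_tilt (laplaceCapUnion_proof h₁ h₂) h₃

/-- The same composition with the cruxes read as the first three hypotheses of the route's
deciding theorem `closes`: the node is what remains of `closes` once `BoundaryTransferWeak` and
`PositivityReduction` are set aside, i.e. `PhaseCapDecay → AmplitudeLDP → TiltStability →
PeriodicBECNonneg` as a closed implication. [folklore] -/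
theorem periodicBECNonneg_of_cruxes_imp :
    PhaseCapDecay → AmplitudeLDP → TiltStability → PeriodicBECNonneg :=
  periodicBECNonneg_of_cruxes

end Summit.AtomisticToContinuum.BoseEinsteinCondensation.Theorems
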